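import Summits.CriticalPhenomena.Ising3DConformalLimit.Theorems.InverseSquareTelemetryPositiveSolutionAsymptoticsAssemblyTools
import Summits.CriticalPhenomena.Ising3DConformalLimit.Theorems.InverseSquareTelemetryEtaBoundsFromTelemetryBarriers
import HarnessLib

/-!
# Crux `PositiveSolutionAsymptotics` (stmt-CriticalPhenomena-4496), line `registered`:
# stub A `stub_blowDownOfBallHarnack`, file 1 — the small comparison balls

THEOREM-ONLY helper file (`--supports stmt-CriticalPhenomena-4496`), imported by
`…PositiveSolutionAsymptoticsBallAssembly.lean` (stub A, the re-plumbed blow-down assembly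
T1 → SH → P → T3 → T4 → S2 of the skeleton `Cruxes/PositiveSolutionAsymptotics/Lines/birth.lean`).
At scale `r` the comparison balls `D = {x : |x - z_c|₂ ≤ R_H}`, `R_H = θ_H r ≤ r/8`, about a
chain point `r/4 ≤ |z_c|₂ ≤ 2r` are finite with
`D ∪ ∂D ⊆ {r/10 ≤ |x|₂ ≤ 3r} ∩ {|x|₂ ≤ 3|z_c|₂}` (`ballAssembly_geometry`); the Dini condition
`||x|₂² V - κ| ≤ C|x|₂^{-ε}` makes `R_H² |V| ≤ c₀` there once `θ_H² (100(κ + C⁺) + 1) ≤ c₀`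
(`ballAssembly_abs_potential_le`, `ballAssembly_exists_theta`). Everything is [folklore].
-/

noncomputable section

namespace Summit.CriticalPhenomena.Ising3DConformalLimit.Theorems.PositiveSolutionAsymptotics

open Literature.Probability.LatticeModels Finset Set Filter Topology
open Summit.CriticalPhenomena.Ising3DConformalLimit.Theorems.PositiveSolutionAsymptotics.Assembly

/-- **Geometry of the small comparison ball.** For a chain point `z_c` with
`r/4 ≤ |z_c|₂ ≤ 2r` (`r ≥ 64`) and a radius `0 ≤ R_H ≤ r/8`, the lattice ball
`D = {x : |x - z_c|₂ ≤ R_H}` is finite and every `x ∈ D ∪ ∂D` has `r/10 ≤ |x|₂ ≤ 3r` and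
`|x|₂ ≤ 3|z_c|₂` (points of `∂D` are within `R_H + 1` of `z_c`, `sqrt_sumSq_step_le`). [folklore] -/
theorem ballAssembly_geometry :
    ∀ (r RH : ℝ), 64 ≤ r → 0 ≤ RH → RH ≤ r / 8 →
    ∀ zc : Literature.Probability.LatticeModels.Site 3,
    r / 4 ≤ Real.sqrt (∑ i, ((zc i : ℤ) : ℝ) ^ 2) → Real.sqrt (∑ i, ((zc i : ℤ) : ℝ) ^ 2) ≤ 2 * r →
    ({x : Literature.Probability.LatticeModels.Site 3 | Real.sqrt (∑ i, (((x i : ℤ) : ℝ) - ((zc i : ℤ) : ℝ)) ^ 2) ≤ RH}).Finite ∧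
    (∀ x ∈ {x : Literature.Probability.LatticeModels.Site 3 | Real.sqrt (∑ i, (((x i : ℤ) : ℝ) - ((zc i : ℤ) : ℝ)) ^ 2) ≤ RH} ∪
        Literature.Probability.LatticeModels.zdOuterBoundary {x : Literature.Probability.LatticeModels.Site 3 | Real.sqrt (∑ i, (((x i : ℤ) : ℝ) - ((zc i : ℤ) : ℝ)) ^ 2) ≤ RH},
      r / 10 ≤ Real.sqrt (∑ i, ((x i : ℤ) : ℝ) ^ 2) ∧ Real.sqrt (∑ i, ((x i : ℤ) : ℝ) ^ 2) ≤ 3 * r ∧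
        Real.sqrt (∑ i, ((x i : ℤ) : ℝ) ^ 2) ≤ 3 * Real.sqrt (∑ i, ((zc i : ℤ) : ℝ) ^ 2)) := by
  intro r RH hr hRH0 hRH zc hzlo hzhi
  set D : Set (Site 3) :=
    {x : Site 3 | Real.sqrt (∑ i, (((x i : ℤ) : ℝ) - ((zc i : ℤ) : ℝ)) ^ 2) ≤ RH} with hD
  -- distance to `zc` on `D ∪ ∂D`
  have hdistU : ∀ x ∈ D ∪ zdOuterBoundary D,
      Real.sqrt (∑ i, (((x i : ℤ) : ℝ) - ((zc i : ℤ) : ℝ)) ^ 2) ≤ r / 8 + 1 := by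
    intro x hx
    rcases hx with hx | ⟨-, y, hy, k, hxy⟩
    · have hx' : Real.sqrt (∑ i, (((x i : ℤ) : ℝ) - ((zc i : ℤ) : ℝ)) ^ 2) ≤ RH := hx
      linarith
    · have hy' : Real.sqrt (∑ i, (((y i : ℤ) : ℝ) - ((zc i : ℤ) : ℝ)) ^ 2) ≤ RH := hy
      rcases hxy with rfl | rfl
      · linarith [(sqrt_sumSq_step_le y zc k).1]
      · linarith [(sqrt_sumSq_step_le y zc k).2]
  -- norms on `D ∪ ∂D`
  have hnormU : ∀ x ∈ D ∪ zdOuterBoundary D,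
      r / 10 ≤ Real.sqrt (∑ i, ((x i : ℤ) : ℝ) ^ 2) ∧ Real.sqrt (∑ i, ((x i : ℤ) : ℝ) ^ 2) ≤ 3 * r ∧
        Real.sqrt (∑ i, ((x i : ℤ) : ℝ) ^ 2) ≤ 3 * Real.sqrt (∑ i, ((zc i : ℤ) : ℝ) ^ 2) := by
    intro x hx
    have hd := hdistU x hx
    have h1 := Literature.Geometry.Lorentzian.sqrt_sum_sq_le_add (fun i => ((x i : ℤ) : ℝ))
      (fun i => ((zc i : ℤ) : ℝ))
    have h2 := sqrt_sumSq_le_add_sub' (fun i => ((x i : ℤ) : ℝ)) (fun i => ((zc i : ℤ) : ℝ))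
    refine ⟨?_, ?_, ?_⟩ <;> linarith
  refine ⟨?_, hnormU⟩
  refine (EtaBoundsFromTelemetry.finite_sumSq_le ((3 * r) ^ 2)).subset fun x hx => ?_
  have h := (hnormU x (Or.inl hx)).2.1
  show ∑ i, ((x i : ℤ) : ℝ) ^ 2 ≤ (3 * r) ^ 2
  exact (Real.sqrt_le_left (by positivity)).1 h

/-- **Smallness of the potential on remote balls.** If `|t² V - κ| ≤ C t^{-ε}` with `t ≥ 1`,
`t ≥ r/10` and `θ² (100(κ + C⁺) + 1) ≤ c₀`, then `|V| ≤ c₀ / (θ r)²`. [folklore] -/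
theorem ballAssembly_abs_potential_le {t Vx κ C ε c₀ θ r : ℝ} (hκ : 0 ≤ κ) (hε : 0 < ε)
    (hr : 0 < r) (hθ : 0 < θ) (ht1 : 1 ≤ t) (htr : r / 10 ≤ t)
    (hV : |t ^ 2 * Vx - κ| ≤ C * t ^ (-ε)) (hθc : θ ^ 2 * (100 * (κ + max C 0) + 1) ≤ c₀) :
    |Vx| ≤ c₀ / (θ * r) ^ 2 := by
  have ht0 : 0 < t := by linarith
  have hpow : t ^ (-ε) ≤ 1 := Real.rpow_le_one_of_one_le_of_nonpos ht1 (by linarith)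
  have hpow0 : 0 ≤ t ^ (-ε) := Real.rpow_nonneg ht0.le _
  have hC : C * t ^ (-ε) ≤ max C 0 :=
    calc C * t ^ (-ε) ≤ max C 0 * t ^ (-ε) := mul_le_mul_of_nonneg_right (le_max_left _ _) hpow0
      _ ≤ max C 0 * 1 := mul_le_mul_of_nonneg_left hpow (le_max_right _ _)
      _ = max C 0 := mul_one _
  have h1 : |t ^ 2 * Vx| ≤ κ + max C 0 := by
    have := abs_sub_abs_le_abs_sub (t ^ 2 * Vx) κ
    rw [abs_of_nonneg hκ] at this
    linarith
  rw [abs_mul, abs_of_nonneg (sq_nonneg t)] at h1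
  have hs : r ^ 2 / 100 ≤ t ^ 2 := by nlinarith
  rw [le_div_iff₀ (by positivity)]
  have h3 : |Vx| * r ^ 2 ≤ 100 * (κ + max C 0) := by
    have hV0 := abs_nonneg Vx
    nlinarith
  calc |Vx| * (θ * r) ^ 2 = θ ^ 2 * (|Vx| * r ^ 2) := by ring
    _ ≤ θ ^ 2 * (100 * (κ + max C 0) + 1) := by
        refine mul_le_mul_of_nonneg_left ?_ (sq_nonneg θ); linarith
    _ ≤ c₀ := hθc

/-- The ratio `θ_H` of the comparison balls: `0 < θ_H ≤ 1/8` with `θ_H² (100(κ + C⁺) + 1) ≤ c₀`.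
[folklore] -/
theorem ballAssembly_exists_theta {κ c₀ : ℝ} (C : ℝ) (hκ : 0 ≤ κ) (hc₀ : 0 < c₀) :
    ∃ θ : ℝ, 0 < θ ∧ θ ≤ 1 / 8 ∧ θ ^ 2 * (100 * (κ + max C 0) + 1) ≤ c₀ := by
  have hA : 0 < 100 * (κ + max C 0) + 1 := by positivity
  set A : ℝ := 100 * (κ + max C 0) + 1 with hAdef
  refine ⟨min (1 / 8) (Real.sqrt (c₀ / A)), lt_min (by norm_num) (Real.sqrt_pos.2 (div_pos hc₀ hA)),
    min_le_left _ _, ?_⟩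
  have hm0 : 0 ≤ min (1 / 8) (Real.sqrt (c₀ / A)) := le_min (by norm_num) (Real.sqrt_nonneg _)
  have h1 : min (1 / 8) (Real.sqrt (c₀ / A)) ^ 2 ≤ c₀ / A :=
    calc min (1 / 8) (Real.sqrt (c₀ / A)) ^ 2 ≤ Real.sqrt (c₀ / A) ^ 2 :=
          pow_le_pow_left₀ hm0 (min_le_right _ _) 2
      _ = c₀ / A := Real.sq_sqrt (div_pos hc₀ hA).le
  rwa [le_div_iff₀ hA] at h1

/-- The loss of one Harnack step `Cst·3^α·(4ηQ + ζ)` is at most `C'·(3ηQ + ζ)` with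
`C' = 2·3^α·Cst`. [folklore] -/
theorem ballAssembly_step_loss {Cst T η Q ζ : ℝ} (hCst : 0 ≤ Cst) (hT : 0 ≤ T) (hη : 0 ≤ η)
    (hQ : 0 ≤ Q) (hζ : 0 ≤ ζ) :
    Cst * T * (4 * η * Q + ζ) ≤ 2 * T * Cst * (3 * η * Q + ζ) := by
  have : 0 ≤ Cst * T * (2 * η * Q + ζ) := by positivity
  nlinarith [this]

end Summit.CriticalPhenomena.Ising3DConformalLimit.Theorems.PositiveSolutionAsymptotics
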